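import Summits.QuantumFields.YangMills.Theses.ThermalRuler
import Literature.Barriers.QuantumFields.FiniteTemperatureInfraredExplicitProofs

/-!
# `LinearDeconfinementWindow` — Borgs–Seiler deconfinement with a linear window `J_E ≥ C₀ · L₀`

Route `ThermalRuler` of `YangMills`, support item `stmt-QuantumFields-11072`
(`Summit.QuantumFields.YangMills.Theses.ThermalRuler.LinearDeconfinementWindow`): for every compact
second-countable group `G`, every continuous unitary `ρ : G →* M_n(ℂ)` with `0 < n` and every space
dimension `d ≥ 3` there is `C₀ = C₀(G, ρ, d) > 0` such that for EVERY temporal extent `L₀ ≥ 1` and all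
couplings `J_E ≥ C₀ · L₀`, `J_M > 0`, the finite-temperature Wilson theory on `ℤ^d × ℤ_{L₀}` has
Polyakov long-range order (`FiniteTemperature.HasPolyakovLongRangeOrder d L₀ ρ J_E J_M`).

## Proof (composition of tree results; Borgs–Seiler 1983 §III)

* Infrared bound with the printed rate (Lemma III.6 / Cor. III.7, p. 348):
  `FiniteTemperature.SliceRP.infrared_bound_even` gives
  `HasPolyakovInfraredBound d L₀ ρ (borgsSeilerRate n L₀)`, `borgsSeilerRate n L₀ J = (1 + 2n/J)^{L₀} − 1`,
  for every continuous unitary `ρ` (faithfulness is not needed; this is the four-line wrapper of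
  `BorgsSeilerInfraredBoundExplicit_holds` without its idle injectivity hypothesis).
* Diagonal bound `G_L(0) ≥ 1` ((III.18)/(III.23), p. 347):
  `FiniteTemperature.one_le_polyakovCorrelation_zero` (reflection positivity in time), for `n ≠ 0`.
* Mechanism (proof of Cor. III.5 / Thm III.7, pp. 347–348, 353):
  `FiniteTemperature.hasPolyakovLongRangeOrder_of_infraredBound` yields long-range order as soon as
  `d · f(J_E) · I < 1`, `I = latticeGreen 0`.
* The LINEAR window (inverting the printed rate): with `K = max(d · I, 0)` and
  `C₀ = 4n(K + 1)`, for `J_E ≥ C₀ L₀` one has `L₀ · (2n/J_E) ≤ 2n/C₀ ≤ 1`, hence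
  `(1 + 2n/J_E)^{L₀} − 1 ≤ exp(2n/C₀) − 1 ≤ 4n/C₀ = 1/(K + 1)` (`1 + y ≤ eʸ`,
  `|eˣ − 1| ≤ 2|x|` for `|x| ≤ 1`), so `d · f · I ≤ K/(K + 1) < 1`.

References: C. Borgs, E. Seiler, Commun. Math. Phys. 91 (1983) 329–380, §III.1 Cor. III.5
(pp. 347–348), §III.2 Lemma III.6, Cor. III.7 (pp. 348–349), Thm III.7 (p. 353). [BorgsSeiler1983]
-/

noncomputable section

open MeasureTheory Filter Topology
open Literature.Barriers.QuantumFields Literature.Barriers.QuantumFields.FiniteTemperature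
open Literature.Probability.LatticeModels (latticeGreen)

namespace Summit.QuantumFields.YangMills.Theorems

namespace LinearDeconfinementWindow

variable {G : Type} [Group G] [TopologicalSpace G] [IsTopologicalGroup G] [CompactSpace G]
  [SecondCountableTopology G] [MeasurableSpace G] [BorelSpace G] {n : ℕ}

/-- **Borgs–Seiler's infrared bound with the printed rate, for every continuous unitary matrix
representation of a compact group** (no faithfulness): `HasPolyakovInfraredBound d L₀ ρ f` with
`f(J_E) = (1 + 2n/J_E)^{L₀} − 1`, every `d`, every `L₀ ≥ 1` — the wrapper of
`FiniteTemperature.SliceRP.infrared_bound_even`, exactly as in `BorgsSeilerInfraredBoundExplicit_holds`.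
[cite: BorgsSeiler1983, §III.2 Lemma III.6 (III.29)–(III.30), Cor. III.7 (III.31) (pp. 348–349)] -/
theorem hasPolyakovInfraredBound_borgsSeilerRate (d L₀ : ℕ) [NeZero L₀]
    (ρ : G →* Matrix (Fin n) (Fin n) ℂ) (hρ : Continuous ρ)
    (hρu : ∀ g, ρ g ∈ Matrix.unitaryGroup (Fin n) ℂ) :
    HasPolyakovInfraredBound d L₀ ρ (borgsSeilerRate n L₀) := by
  intro L _ hL h4 JE JM hJE hJM k i _hk
  obtain ⟨d', rfl⟩ : ∃ d', d = d' + 1 := ⟨d - 1, (Nat.succ_pred_eq_of_pos (Fin.pos i)).symm⟩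
  obtain ⟨m, hm⟩ := hL
  obtain ⟨n', hn', rfl⟩ : ∃ n', 1 ≤ n' ∧ L = 2 * n' + 2 := ⟨m - 1, by omega, by omega⟩
  exact SliceRP.infrared_bound_even (L₀ := L₀) i ρ hρu hρ hn' hJE hJM k

/-- **Borgs–Seiler's diagonal bound `G_L(0) ≥ 1` as the predicate `HasPolyakovDiagonalBound`**, for
every continuous unitary `n × n` representation with `0 < n` (reflection positivity in time,
`FiniteTemperature.one_le_polyakovCorrelation_zero`).
[cite: BorgsSeiler1983, §III.1 (III.18), (III.23)–(III.25) (p. 347)] -/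
theorem hasPolyakovDiagonalBound_of_unitary (d L₀ : ℕ) [NeZero L₀]
    (ρ : G →* Matrix (Fin n) (Fin n) ℂ) (hρ : Continuous ρ)
    (hρu : ∀ g, ρ g ∈ Matrix.unitaryGroup (Fin n) ℂ) (hn : 0 < n) :
    HasPolyakovDiagonalBound d L₀ ρ := by
  intro L _ _hL _h4 JE JM hJE _hJM
  exact one_le_polyakovCorrelation_zero ρ hρu hρ (Nat.pos_iff_ne_zero.1 hn) hJE.le JM

/-- **Inverting the printed rate (the linear window).** For `K ≥ 0`, `0 < n`, `C₀ = 4n(K+1)`,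
`1 ≤ L₀` and `J ≥ C₀ · L₀`: `K · ((1 + 2n/J)^{L₀} − 1) < 1`. [folklore] -/
theorem rate_window {K : ℝ} (hK : 0 ≤ K) {n L₀ : ℕ} (hn : 0 < n) (hL₀ : 1 ≤ L₀) {J : ℝ}
    (hJ : 4 * (n : ℝ) * (K + 1) * L₀ ≤ J) :
    K * ((1 + 2 * (n : ℝ) / J) ^ L₀ - 1) < 1 := by
  have hn' : (0 : ℝ) < n := Nat.cast_pos.2 hn
  have hL₀' : (1 : ℝ) ≤ L₀ := by exact_mod_cast hL₀
  have hC₀ : 0 < 4 * (n : ℝ) * (K + 1) := by positivity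
  have hJpos : 0 < J := lt_of_lt_of_le (by positivity) hJ
  -- `y = 2n/J ≥ 0` and `L₀ · y ≤ x := 2n/C₀ ≤ 1/2`
  set y : ℝ := 2 * (n : ℝ) / J with hy
  have hy0 : 0 ≤ y := by positivity
  set x : ℝ := 1 / (2 * (K + 1)) with hx
  have hx0 : 0 ≤ x := by positivity
  have hx1 : x ≤ 1 := by
    rw [hx, div_le_one (by positivity)]
    nlinarith
  have hLy : (L₀ : ℝ) * y ≤ x := by
    rw [hy, hx, mul_div_assoc', div_le_div_iff₀ hJpos (by positivity)]
    nlinarith [hJ, hL₀']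
  -- `(1 + y)^{L₀} ≤ exp(L₀ y) ≤ exp x`
  have hpow : (1 + y) ^ L₀ ≤ Real.exp x := by
    calc (1 + y) ^ L₀ ≤ (Real.exp y) ^ L₀ := by
          refine pow_le_pow_left₀ (by positivity) ?_ L₀
          have := Real.add_one_le_exp y
          linarith
      _ = Real.exp ((L₀ : ℝ) * y) := by rw [← Real.exp_nat_mul]
      _ ≤ Real.exp x := Real.exp_le_exp.2 hLy
  -- `exp x − 1 ≤ 2x`
  have hexp : Real.exp x - 1 ≤ 2 * x := by
    have h := Real.abs_exp_sub_one_le (x := x) (by rwa [abs_of_nonneg hx0])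
    rw [abs_of_nonneg hx0] at h
    exact (le_abs_self _).trans h
  have h2x : 2 * x = 1 / (K + 1) := by
    rw [hx]; field_simp
  have hK1 : 0 < K + 1 := by linarith
  calc K * ((1 + y) ^ L₀ - 1) ≤ K * (2 * x) := by
        refine mul_le_mul_of_nonneg_left ?_ hK
        linarith
    _ = K / (K + 1) := by rw [h2x]; ring
    _ < 1 := by rw [div_lt_one hK1]; linarith

end LinearDeconfinementWindow

open LinearDeconfinementWindow in
/-- **`LinearDeconfinementWindow` (route `ThermalRuler`, item `stmt-QuantumFields-11072`).** For every
compact second-countable `G`, every continuous unitary `ρ : G →* M_n(ℂ)` with `0 < n` and every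
`d ≥ 3` there is `C₀ > 0` (here `C₀ = 4n(K + 1)`, `K = max(d · latticeGreen 0, 0)`) such that for
every temporal extent `L₀ ≥ 1` and all `J_E ≥ C₀ L₀`, `J_M > 0`, the Polyakov loops of the
finite-temperature Wilson theory on `ℤ^d × ℤ_{L₀}` have long-range order — Borgs–Seiler's
Thm III.7 with the linear window read off from the printed rate `f(J_E) = (1 + 2χ(1)/J_E)^{L₀} − 1`
of Lemma III.6. [cite: BorgsSeiler1983, §III.2 Lemma III.6 (p. 348), Thm III.7 (p. 353); §III.1 Cor. III.5 (pp. 347–348)] -/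
theorem LinearDeconfinementWindow_proof :
    Summit.QuantumFields.YangMills.Theses.ThermalRuler.LinearDeconfinementWindow := by
  unfold Summit.QuantumFields.YangMills.Theses.ThermalRuler.LinearDeconfinementWindow
  intro G _ _ _ _ _ _ _ n d ρ hρ hρu hn hd
  set K : ℝ := max ((d : ℝ) * latticeGreen (0 : Fin d → ℤ)) 0 with hK
  have hK0 : 0 ≤ K := le_max_right _ _
  refine ⟨4 * (n : ℝ) * (K + 1), by positivity, fun L₀ _ JE JM hJE hJM => ?_⟩
  have hL₀ : 1 ≤ L₀ := Nat.one_le_iff_ne_zero.2 (NeZero.ne L₀)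
  have hJEpos : 0 < JE := by
    have : (0 : ℝ) < 4 * (n : ℝ) * (K + 1) * L₀ := by
      have : (0 : ℝ) < n := Nat.cast_pos.2 hn
      have : (1 : ℝ) ≤ L₀ := by exact_mod_cast hL₀
      positivity
    linarith
  refine hasPolyakovLongRangeOrder_of_infraredBound ρ hρ hd
    (hasPolyakovInfraredBound_borgsSeilerRate d L₀ ρ hρ hρu)
    (hasPolyakovDiagonalBound_of_unitary d L₀ ρ hρ hρu hn) hJEpos hJM ?_
  -- `d · f(J_E) · I ≤ K · f(J_E) < 1`
  have hf0 : 0 ≤ borgsSeilerRate n L₀ JE := by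
    unfold borgsSeilerRate
    have : (1 : ℝ) ≤ (1 + 2 * (n : ℝ) / JE) ^ L₀ := one_le_pow₀ (by
      have : 0 ≤ 2 * (n : ℝ) / JE := by positivity
      linarith)
    linarith
  have hwin : K * borgsSeilerRate n L₀ JE < 1 := rate_window hK0 hn hL₀ hJE
  calc (d : ℝ) * borgsSeilerRate n L₀ JE * latticeGreen (0 : Fin d → ℤ)
      = ((d : ℝ) * latticeGreen (0 : Fin d → ℤ)) * borgsSeilerRate n L₀ JE := by ring
    _ ≤ K * borgsSeilerRate n L₀ JE := mul_le_mul_of_nonneg_right (le_max_left _ _) hf0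
    _ < 1 := hwin

end Summit.QuantumFields.YangMills.Theorems

end
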